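import Summits.BirchSwinnertonDyer.BirchSwinnertonDyer.Theorems.ByReductionTypeAtTwoAdditiveKatoTransportQuadraticTwistModel
import Summits.BirchSwinnertonDyer.BirchSwinnertonDyer.Theorems.ByReductionTypeAtTwoAdditiveKatoTransportQuadraticLayerPrint
import Summits.BirchSwinnertonDyer.BirchSwinnertonDyer.Theorems.ByReductionTypeAtTwoAdditiveKatoTransportPrintExactAnyImageTorsion
import Summits.BirchSwinnertonDyer.BirchSwinnertonDyer.Theorems.ByReductionTypeAtTwoAdditiveKatoTransportQuadraticLayerNegTwo
import Literature.NumberTheory.EllipticCurves.Greenberg1999.SelmerCotorsionMultiplicativeAbelian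
import HarnessLib

/-!
# Route ByReductionTypeAtTwo, crux `AdditivePotMultOverKAtTwo` (stmt-BirchSwinnertonDyer-22618) — T20 (a) «twist
# decomposition» for EVERY imaginary quadratic twist `d < 0` FROM PRINT: `ℓ_𝔮(X(W/ℚ_∞)) = ℓ_{ι𝔮}(X(W/ℚ_∞))` (height-one
# `𝔮 ∌ 2`) for the ADDITIVE `W ≅ (W′)^{(d)}`, `W′` split multiplicative at `2`, from Greenberg 1.14 ×2 + Greenberg 1.5 (abelian)

Cell `bsd-2adic`, seat `bsd-2adic-t42` GEN 24, part C-2 (coordinated with k4-w3 GEN 5, who owns the object-level doors); sequel of `…QuadraticTwistModel` (the model identification for every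
imaginary quadratic `F = ℚ(√d)`). HONEST FRAMING (D-0036 / D-0054): theorems only; types-the-object-of → shrinks-literal (T20 (a)
and the torsion of `X(W/ℚ_∞)`, `X(W′/ℚ_∞)` ↦ PRINT by name + kernel, on BOTH split-twist blocks); closes none; nothing booked; BSD
is not proved by any of this. PARTITION: X5@2 additive, C4″ 22618, all four (−1)/(−2) × irreducible/reducible split-twist
sub-blocks × `p = 2`.

* §1 GEN 23's A3 §2–§3 for general `d` (uniform in the block): `hdec_of_model_of_sq_eq`, `isTorsion_model_iff_of_sq_eq`,
  `lengthAt_selmerDual_symm_of_model_of_sq_eq` (modulo a model `ΘS`; the `d = −1` / `d = −2` instances are t42 GEN 23's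
  `AddKatoTwoQuadLayer.…` and k4-w3 GEN 5's `…_negTwo`; the complex-conjugation lemma is k4-w3's
  `exists_mem_kerSubgroup_smul_sqrt_eq_neg_of_neg`, the newform transfer k4-w3's `isNewformOf_twistModel` — reused by import).
* §2 **`isTorsion_of_thm15_abelian_of_sq_eq`** (`X(W′/ℚ_∞)`, `X(W/ℚ_∞)` torsion ⟸ Greenberg 1.5 over the abelian `F = ℚ(√d)`) and
  **`lengthAt_selmerDual_symm_of_sq_eq_print`**: T20 (a) BY NAME for every `d < 0` from PRINT {`Greenberg1999_thm114_…` over `ℚ`,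
  `…thm114_…_splitMult_baseChange` over `F`, `…thm15_isTorsion_multiplicative_abelian`} + the class data (`V • W = W′^{(d)}`,
  `W^{(d)}` split multiplicative at `2` with newform `f`) + the field data (`F ∋ θ_F`, `θ_F² = d`, `[F : ℚ] = 2`) — no torsion
  hypothesis, no model, no `F`-side tower/dual.

References: [GreenbergLNM1716] §1 p. 60, Thm. 1.5 p. 61, Thm. 1.14 p. 68, §4 p. 107; [DokchitserDokchitserAnnals2010] Lemma 4.14;
[Washington1997] §13.1; [SilvermanAEC2009] VII.5 Prop. 5.1, X.5 Cor. 5.4, App. C §16; memo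
`run/shared/lean/pub/bsd-2adic/t42/DESIGN-T42-ADDENDUM-28.md`.
-/

set_option autoImplicit false
-- the summit's namespace `Summit.BirchSwinnertonDyer.BirchSwinnertonDyer` (Sub = Summit) trips `dupNamespace`
set_option linter.dupNamespace false

noncomputable section

open scoped Classical MatrixGroups ModularForm NumberField

open Field CongruenceSubgroup WeierstrassCurve IsDedekindDomain
  Literature.NumberTheory.EllipticCurves Literature.NumberTheory.EllipticCurves.ModularForms
  Literature.NumberTheory.EllipticCurves.Module Literature.NumberTheory.EllipticCurves.QuadraticLayer
  Literature.NumberTheory.GaloisRepresentations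

namespace Summit.BirchSwinnertonDyer.BirchSwinnertonDyer.Theorems.AddKatoTwoQuadLayerTwist

universe v

/-! ## §1 The decomposition reading and T20 (a) modulo a model, general `d` -/

section Model

variable (κ : ZpExtension ℚ 2) (W' W : WeierstrassCurve ℚ) {V : VariableChange ℚ} {d : ℚ} (hd : d < 0)
  (hV : V • W = W'.quadraticTwist d)
  {θ : AlgebraicClosure ℚ} (hθ : θ ^ 2 = algebraMap ℚ (AlgebraicClosure ℚ) d)
  {γ : absoluteGaloisGroup ℚ} (hγθ : γ • θ = θ)
  {F : Type v} [Field F] [NumberField F] {WF : WeierstrassCurve F} {κF : ZpExtension F 2}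
  {γF : absoluteGaloisGroup F} [(kerStab κ θ).Normal]
  (ΘS : WF.selmerInfty κF ≃+ W'.selmerGroupOver 2 (kerStab κ θ))
  (hΘS : ∀ s, ((ΘS (WF.conjSelmerInfty κF γF s) : W'.selmerGroupOver 2 (kerStab κ θ)) : W'.subgroupH1 2 (kerStab κ θ)) =
    W'.conjH1 2 (kerStab κ θ) γ (ΘS s : W'.selmerGroupOver 2 (kerStab κ θ)))
  (D' : W'.SelmerDualData κ γ) (D : W.SelmerDualData κ γ)

/-- `(2 : Λ) = C 2`. [folklore] -/
private theorem two_eq_C : (2 : IwasawaAlgebra 2) = PowerSeries.C (2 : ℤ_[2]) := by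
  rw [show (2 : ℤ_[2]) = ((2 : ℕ) : ℤ_[2]) by norm_num, map_natCast]; norm_num

include hd hV hθ hγθ hΘS in
/-- **The decomposition reading `hdec` for a general imaginary quadratic twist**: `ℓ_𝔮(D_F.X) = ℓ_𝔮(X(W′/ℚ_∞)) + ℓ_𝔮(X(W/ℚ_∞))` at
every prime `𝔮 ∌ C 2`, for `W` a `ℚ`-model of `(W′)^{(d)}`, `θ² = d < 0`, `γ` fixing `θ`, and any dual datum `D_F` identified with the
subgroup model of `Sel(W′/ℚ_∞(θ))` (GEN 23's `lengthAt_eq_add_of_quadraticLayer` + k4-w3's complex conjugation in `ker κ`). The case `d = −1` is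
`AddKatoTwoQuadLayer.hdec_of_model`. [cite: GreenbergLNM1716, §4 p. 107] [cite: DokchitserDokchitserAnnals2010, Lemma 4.14] -/
theorem hdec_of_model_of_sq_eq (DF : WF.SelmerDualData κF γF) (𝔮 : PrimeSpectrum (IwasawaAlgebra 2))
    (hp𝔮 : PowerSeries.C (2 : ℤ_[2]) ∉ 𝔮.asIdeal) :
    lengthAt (IwasawaAlgebra 2) DF.X 𝔮 =
      lengthAt (IwasawaAlgebra 2) D'.X 𝔮 + lengthAt (IwasawaAlgebra 2) D.X 𝔮 := by
  obtain ⟨c, hcκ, hcθ⟩ := AddKatoTwoQuadLayer.exists_mem_kerSubgroup_smul_sqrt_eq_neg_of_neg κ hd hθ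
  exact lengthAt_eq_add_of_quadraticLayer κ W' W hd.ne hV hθ hcκ hcθ hγθ ΘS hΘS D' D DF 𝔮 (by rw [two_eq_C]; exact hp𝔮)

include hd hV hθ hγθ hΘS in
/-- **Torsion transfers through the model**, general `d`: `D_F` torsion ⟺ `X(W′/ℚ_∞)` and `X(W/ℚ_∞)` torsion.
[cite: DokchitserDokchitserAnnals2010, Lemma 4.14] -/
theorem isTorsion_model_iff_of_sq_eq (DF : WF.SelmerDualData κF γF) : DF.IsTorsion ↔ D'.IsTorsion ∧ D.IsTorsion := by
  obtain ⟨c, hcκ, hcθ⟩ := AddKatoTwoQuadLayer.exists_mem_kerSubgroup_smul_sqrt_eq_neg_of_neg κ hd hθ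
  exact isTorsion_iff_of_quadraticLayer κ W' W hd.ne hV hθ hcκ hcθ hγθ ΘS hΘS D' D DF

end Model

section SymmetryModel

variable (h114 : Greenberg1999_thm114_charIdeal_iota_invariant)
  (h114F : Greenberg1999.thm114_charIdeal_iota_invariant_splitMult_baseChange)
  (W' : WeierstrassCurve ℚ) [W'.IsElliptic] [W'.IsGloballyMinimal] (hmult' : W'.HasMultiplicativeReductionAtPrime 2)
  (W : WeierstrassCurve ℚ) {V : VariableChange ℚ} {d : ℚ} (hV : V • W = W'.quadraticTwist d)
  {θ : AlgebraicClosure ℚ} (hθ : θ ^ 2 = algebraMap ℚ (AlgebraicClosure ℚ) d)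
  (κ : ZpExtension ℚ 2) (γ : absoluteGaloisGroup ℚ) (hκ : κ.IsCyclotomic) (hγ : κ.IsTopGenerator γ) (hγθ : γ • θ = θ)
  (D' : W'.SelmerDualData κ γ) [Module.Finite (IwasawaAlgebra 2) D'.X] (hD' : D'.IsTorsion)
  (D : W.SelmerDualData κ γ) (hD : D.IsTorsion)
  (F : Type) [Field F] [NumberField F]
  (hF : ∀ v : HeightOneSpectrum (𝓞 F), (2 : 𝓞 F) ∈ v.asIdeal → (W'.baseChange F).HasSplitMultiplicativeReductionAt v)
  (κF : ZpExtension F 2) (γF : absoluteGaloisGroup F) (hκF : κF.IsCyclotomic) (hγF : κF.IsTopGenerator γF)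
  (DF : (W'.baseChange F).SelmerDualData κF γF) [Module.Finite (IwasawaAlgebra 2) DF.X] [(kerStab κ θ).Normal]
  (ΘS : (W'.baseChange F).selmerInfty κF ≃+ W'.selmerGroupOver 2 (kerStab κ θ))
  (hΘS : ∀ s, ((ΘS ((W'.baseChange F).conjSelmerInfty κF γF s) : W'.selmerGroupOver 2 (kerStab κ θ)) :
      W'.subgroupH1 2 (kerStab κ θ)) = W'.conjH1 2 (kerStab κ θ) γ (ΘS s : W'.selmerGroupOver 2 (kerStab κ θ)))

include h114 h114F hmult' hV hθ hκ hγ hγθ hD' hD hF hκF hγF DF hΘS in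
/-- **T20 (a) modulo a model, general `d`**: `ℓ_𝔮(X(W/ℚ_∞)) = ℓ_{ι𝔮}(X(W/ℚ_∞))` at every height-one `𝔮 ∌ 2` for `W ≅ (W′)^{(d)}`
(`W′` multiplicative at `2`, split multiplicative above `2` over `F`), from Greenberg 1.14 over `ℚ` and over `F` (PRINT), torsion of
`X(W′/ℚ_∞)` and `X(W/ℚ_∞)`, and a model `ΘS` — GEN 23's `lengthAt_selmerDual_symm_of_model` for general `d`.
[cite: GreenbergLNM1716, Thm. 1.14 (p. 68) and §1 (p. 60)] [cite: DokchitserDokchitserAnnals2010, Lemma 4.14] -/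
theorem lengthAt_selmerDual_symm_of_model_of_sq_eq (hd : d < 0) (𝔮 : PrimeSpectrum (IwasawaAlgebra 2))
    (h𝔮 : 𝔮.asIdeal.height = 1) (hp𝔮 : PowerSeries.C (2 : ℤ_[2]) ∉ 𝔮.asIdeal) :
    lengthAt (IwasawaAlgebra 2) D.X 𝔮 =
      lengthAt (IwasawaAlgebra 2) D.X (PrimeSpectrum.comap (IwasawaAlgebra.invol 2).toRingHom 𝔮) := by
  have hDF : DF.IsTorsion := (isTorsion_model_iff_of_sq_eq κ W' W hd hV hθ hγθ ΘS hΘS D' D DF).mpr ⟨hD', hD⟩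
  exact AddKatoTwo.lengthAt_selmerDual_symm_of_decomposition h114 h114F W' hmult' F hF κF γF hκF hγF DF hDF κ γ hκ hγ
    D' hD' D (fun 𝔮' _ hp𝔮' ↦ hdec_of_model_of_sq_eq κ W' W hd hV hθ hγθ ΘS hΘS D' D DF 𝔮' hp𝔮') 𝔮 h𝔮 hp𝔮

end SymmetryModel

/-! ## §2 T20 (a) and the torsion of `X(W/ℚ_∞)`, `X(W′/ℚ_∞)` FROM PRINT, every `d < 0` -/

section Print

-- adapted from k4-w3 GEN 5's `AddKatoTwo.hasSplitMultiplicativeReductionAtPrime_twistModel` (`…PrintExactAnyImageModelDoors`)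
/-- `W′ ≅_ℚ W^{(d)}` is split multiplicative at `ℓ` when `W^{(d)}` is (`V • W = W′^{(d)}`, `d ≠ 0`).
[cite: SilvermanAEC2009, VII.5 Prop. 5.1 (b), X.5 Cor. 5.4] -/
private theorem hasSplitMultiplicativeReductionAtPrime_of_twistModel (W W' : WeierstrassCurve ℚ) [W.IsElliptic] [W'.IsElliptic]
    {V : VariableChange ℚ} {d : ℚ} (hd : d ≠ 0) (hV : V • W = W'.quadraticTwist d) (ℓ : ℕ) [Fact ℓ.Prime]
    (hsp : (W.quadraticTwist d).HasSplitMultiplicativeReductionAtPrime ℓ) : W'.HasSplitMultiplicativeReductionAtPrime ℓ := by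
  haveI : (W.quadraticTwist d).IsElliptic := W.isElliptic_quadraticTwist hd
  obtain ⟨C₁, hC₁⟩ := W'.exists_variableChange_quadraticTwist_one
  obtain ⟨C₂, hC₂⟩ := W'.exists_variableChange_quadraticTwist_mul_sq 1 d hd
  have htw : (C₂ * C₁) • W' = (⟨V.u, d * V.r, 0, 0⟩ : VariableChange ℚ) • W.quadraticTwist d := by
    rw [mul_smul, hC₁, hC₂, ← quadraticTwist_smul, hV, quadraticTwist_quadraticTwist]
    ring_nf
  rw [← hasSplitMultiplicativeReductionAtPrime_smul_iff W' (C₂ * C₁) ℓ, htw, hasSplitMultiplicativeReductionAtPrime_smul_iff]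
  exact hsp

variable (h114 : Greenberg1999_thm114_charIdeal_iota_invariant)
  (h114F : Greenberg1999.thm114_charIdeal_iota_invariant_splitMult_baseChange)
  (h15F : Greenberg1999.thm15_isTorsion_multiplicative_abelian)
  (W' : WeierstrassCurve ℚ) [W'.IsElliptic] [W'.IsGloballyMinimal]
  (W : WeierstrassCurve ℚ) [W.IsElliptic] {V : VariableChange ℚ} {d : ℚ} (hd : d < 0) (hV : V • W = W'.quadraticTwist d)
  {θ : AlgebraicClosure ℚ} (hθ : θ ^ 2 = algebraMap ℚ (AlgebraicClosure ℚ) d)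
  {N : ℕ} [NeZero N] (f : CuspForm (Gamma0 N) 2) (hf : IsNewformOf (W.quadraticTwist d) f)
  (hsp : (W.quadraticTwist d).HasSplitMultiplicativeReductionAtPrime 2)
  (κ : ZpExtension ℚ 2) (γ : absoluteGaloisGroup ℚ) (hκ : κ.IsCyclotomic) (hγ : κ.IsTopGenerator γ) (hγθ : γ • θ = θ)

include h15F hd hV hθ hf hsp hκ hγ hγθ in
/-- **`X(W′/ℚ_∞)` and `X(W/ℚ_∞)` are `Λ`-torsion** for `V • W = W′^{(d)}`, `W^{(d)}` split multiplicative at `2` with newform `f`,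
`θ² = d < 0`, `γ` fixing `θ`, and ANY dual data `D′`, `D`: Greenberg's Thm 1.5 over the abelian field `F ∋ θ_F` (`θ_F² = d`) makes
`X((W′)_F/F_∞)` torsion, and the quadratic-layer decomposition through the model (`isTorsion_model_iff_of_sq_eq`,
`exists_selmerInfty_model_of_sq_eq`) transfers torsion to both factors — in particular to the ADDITIVE curve `W`.
[cite: GreenbergLNM1716, Thm. 1.5 (p. 61) and §4 p. 107] [cite: DokchitserDokchitserAnnals2010, Lemma 4.14] -/
theorem isTorsion_of_thm15_abelian_of_sq_eq (F : Type) [Field F] [NumberField F] {θF : F}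
    (hθF : θF ^ 2 = algebraMap ℚ F d) (hF2 : Module.finrank ℚ F = 2) (D' : W'.SelmerDualData κ γ) (D : W.SelmerDualData κ γ) :
    D'.IsTorsion ∧ D.IsTorsion := by
  haveI : Fact (Nat.Prime 2) := ⟨Nat.prime_two⟩
  haveI : (kerStab κ θ).Normal := normal_kerStab κ hθ
  have hsp' : W'.HasSplitMultiplicativeReductionAtPrime 2 := hasSplitMultiplicativeReductionAtPrime_of_twistModel W W' hd.ne hV 2 hsp
  obtain ⟨κF, γF, hκF, hγF, -, -, ΘS, hΘS⟩ := exists_selmerInfty_model_of_sq_eq κ hκ W' hθ hγ hγθ hd F hθF hF2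
  let DF : (W'.baseChange F).SelmerDualData κF γF := (W'.baseChange F).selmerDualData κF hγF
  haveI : Algebra.IsQuadraticExtension ℚ F := ⟨hF2⟩
  haveI : IsAbelianGalois ℚ F := IsAbelianGalois.of_isCyclic ℚ F
  have hDF : DF.IsTorsion := h15F W' 2 hsp'.hasMultiplicativeReductionAtPrime f (AddKatoTwo.isNewformOf_twistModel W W' hd.ne hV hf)
    F κF γF hκF hγF DF
  exact (isTorsion_model_iff_of_sq_eq κ W' W hd hV hθ hγθ ΘS hΘS D' D DF).mp hDF

include h114 h114F h15F hd hV hθ hf hsp hκ hγ hγθ in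
/-- **T20 (a) BY NAME FROM PRINT, every imaginary quadratic twist**: `ℓ_𝔮(X(W/ℚ_∞)) = ℓ_{ι𝔮}(X(W/ℚ_∞))` at every height-one
`𝔮 ∌ 2` for the (additive) `W` with `V • W = W′^{(d)}`, `W′` globally minimal, `W^{(d)}` split multiplicative at `2` with newform `f`,
`d < 0`, and ANY dual datum `D` keyed by a topological generator `γ` fixing `θ` (`θ² = d`), given a quadratic field `F ∋ θ_F` with
`θ_F² = d` (data) — from the PRINT facts Greenberg 1.14 over `ℚ`, Greenberg 1.14 over `F` (split multiplicative) and Greenberg 1.5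
over the abelian `F`, and NOTHING ELSE: `W′` is split multiplicative above `2` over `F` in the kernel
(`hasSplitMultiplicativeReductionAt_baseChange_of_two_mem`), the torsion inputs come from `isTorsion_of_thm15_abelian_of_sq_eq`, the
model from `exists_selmerInfty_model_of_sq_eq`. The hypothesis `hXsym`/`hXι` of every split-twist-block door of the lane.
[cite: GreenbergLNM1716, Thm. 1.14 (p. 68), Thm. 1.5 (p. 61), §1 (p. 60)] [cite: DokchitserDokchitserAnnals2010, Lemma 4.14] -/
theorem lengthAt_selmerDual_symm_of_sq_eq_print (F : Type) [Field F] [NumberField F] {θF : F}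
    (hθF : θF ^ 2 = algebraMap ℚ F d) (hF2 : Module.finrank ℚ F = 2) (D : W.SelmerDualData κ γ)
    (𝔮 : PrimeSpectrum (IwasawaAlgebra 2)) (h𝔮 : 𝔮.asIdeal.height = 1) (hp𝔮 : PowerSeries.C (2 : ℤ_[2]) ∉ 𝔮.asIdeal) :
    lengthAt (IwasawaAlgebra 2) D.X 𝔮 =
      lengthAt (IwasawaAlgebra 2) D.X (PrimeSpectrum.comap (IwasawaAlgebra.invol 2).toRingHom 𝔮) := by
  haveI : Fact (Nat.Prime 2) := ⟨Nat.prime_two⟩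
  haveI : (kerStab κ θ).Normal := normal_kerStab κ hθ
  have hsp' : W'.HasSplitMultiplicativeReductionAtPrime 2 := hasSplitMultiplicativeReductionAtPrime_of_twistModel W W' hd.ne hV 2 hsp
  have hmult' : W'.HasMultiplicativeReductionAtPrime 2 := hsp'.hasMultiplicativeReductionAtPrime
  let D' : W'.SelmerDualData κ γ := W'.selmerDualData κ hγ
  haveI : Module.Finite (IwasawaAlgebra 2) D'.X := D'.module_finite_holds hγ
  obtain ⟨hD', hD⟩ := isTorsion_of_thm15_abelian_of_sq_eq h15F W' W hd hV hθ f hf hsp κ γ hκ hγ hγθ F hθF hF2 D' D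
  obtain ⟨κF, γF, hκF, hγF, -, -, ΘS, hΘS⟩ := exists_selmerInfty_model_of_sq_eq κ hκ W' hθ hγ hγθ hd F hθF hF2
  let DF : (W'.baseChange F).SelmerDualData κF γF := (W'.baseChange F).selmerDualData κF hγF
  haveI : Module.Finite (IwasawaAlgebra 2) DF.X := DF.module_finite_holds hγF
  exact lengthAt_selmerDual_symm_of_model_of_sq_eq h114 h114F W' hmult' W hV hθ κ γ hκ hγ hγθ D' hD' D hD F
    (fun v hv ↦ AddKatoTwoQuadLayerModel.hasSplitMultiplicativeReductionAt_baseChange_of_two_mem W' hsp' F v hv) κF γF hκF hγF DF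
    ΘS hΘS hd 𝔮 h𝔮 hp𝔮

end Print

end Summit.BirchSwinnertonDyer.BirchSwinnertonDyer.Theorems.AddKatoTwoQuadLayerTwist

end
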